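import Mathlib
import HarnessLib
import Literature.AlgebraicGeometry.Resolution.MvPolynomialKillVars
import Summits.ResolutionOfSingularities.ResolutionOfSingularities.Theorems.FrobeniusClosingPatchingRelPerfectJacobianCriterion

/-!
# S1a — R4c cusp, brick (b2): K1′ OF A HYPERSURFACE MEMBER `(x_{v₀}, φ)` IN `k[x_ι][1/h]` BY THE JACOBIAN CRITERION

[OURS · L1 W4.5c · lead-1 g17; plan-1 RULING R-F15v (2) ★ R4c `cusp_killsIn_two`, SPEC `Cruxes/CyclicQuotientFourfolds/Lines/s1a_logminvertex-R4c-SPEC.md` §2/§3 (b2), (b5):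
the member generators of the cusp line are `X₀′` and a HYPERSURFACE `φ` in the other variables (`X₂′² − X₁′³` on the `O`-side chart, the implicit graph `T′` on the
`Q`-side chart) — NOT a graph, so ✓`FreeModel.isRegular_away_X_graph` does not apply. This file proves the K1′ pair (regular sequence + regular quotient ring) for
`(x_{v₀}, φ)`, `φ = rename φ₀` not involving `x_{v₀}`, in `P = k[x_ι][1/h]`, from a POINTWISE JACOBIAN CERTIFICATE: at every prime `Q ∋ x_{v₀}, φ` with `h ∉ Q` some
`∂φ₀/∂x_j ∉ Q` (tree ✓`MvPolynomial.isRegularLocalRing_atPrime_quotient_of_pderiv_notMem`, [cite: Matsumura1987, Thm. 14.2]), plus a `k`-point of `V(x_{v₀}, φ) ∩ D(h)`]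
— NOT statements of the manuscript; counted 0; AI-level work, weaker than expert review. Crux stmt-ResolutionOfSingularities-17941 `CyclicQuotientFourfolds`, line
`s1a-logminvertex` v13 (`stub_reachLowerInFX`).

* `FreeModel.isRegularRing_of_away_of_forall` — a localisation `S = A[1/h]` is a regular ring as soon as `A_𝔮` is regular for every prime `𝔮 ∌ h`;
* `FreeModel.exists_quot_X_hypersurface_equiv` — `k[x_{ι∖v₀}] ⧸ (φ₀) ≅ k[x_ι] ⧸ (x_{v₀}, rename φ₀)` with its value on classes;
* ★★ `FreeModel.isRegular_away_X_hypersurface` — the K1′ pair for `(x_{v₀}, rename φ₀)` in `k[x_ι][1/h]`.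
-/

set_option linter.dupNamespace false

noncomputable section

open MvPolynomial
open Literature.AlgebraicGeometry.Resolution
open Summit.ResolutionOfSingularities.ResolutionOfSingularities.Theorems

namespace Summit.ResolutionOfSingularities.ResolutionOfSingularities.Theorems.WildQuotientResolution.S1.FreeModel

/-- **`A[1/h]` is a regular ring as soon as `A_𝔮` is a regular local ring for every prime `𝔮 ∌ h`** (`A` Noetherian; any localisation `S` of `A` away from `h`):
the local rings of `S` are the `A_𝔮`, `𝔮 ∈ D(h)`. [folklore] -/
theorem isRegularRing_of_away_of_forall {A S : Type*} [CommRing A] [IsNoetherianRing A] [CommRing S] [Algebra A S] (h : A)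
    [IsLocalization.Away h S] (hreg : ∀ (𝔮 : Ideal A) [𝔮.IsPrime], h ∉ 𝔮 → IsRegularLocalRing (Localization.AtPrime 𝔮)) :
    IsRegularRing S := by
  haveI : IsNoetherianRing S := IsLocalization.isNoetherianRing (Submonoid.powers h) S inferInstance
  refine (isRegularRing_iff (R := S)).2 fun P hP => ?_
  haveI : IsLocalization.AtPrime (Localization.AtPrime P) (P.under A) :=
    IsLocalization.isLocalization_isLocalization_atPrime_isLocalization (Submonoid.powers h) (Localization.AtPrime P) P
  have hh : h ∉ P.under A := fun hhP =>
    hP.ne_top (P.eq_top_of_isUnit_mem (Ideal.mem_comap.1 hhP) (IsLocalization.Away.algebraMap_isUnit h))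
  haveI := hreg (P.under A) hh
  exact IsRegularLocalRing.of_ringEquiv (R := Localization.AtPrime (P.under A))
    (IsLocalization.algEquiv (P.under A).primeCompl (Localization.AtPrime (P.under A)) (Localization.AtPrime P)).toRingEquiv

variable {k : Type} [Field k] {ι : Type}

/-- **`k[x_j : j ≠ v₀] ⧸ (φ₀) ≅ k[x_ι] ⧸ (x_{v₀}, rename φ₀)`** (kill the variable `x_{v₀}` ✓`quotientSpanXEquiv`, then the third isomorphism theorem), with its
value on classes. [cite: StacksProject, Tag 0BIQ; folklore] -/
theorem exists_quot_X_hypersurface_equiv (v₀ : ι) (φ₀ : MvPolynomial {j : ι // j ∉ ({v₀} : Set ι)} k) :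
    ∃ eq : (MvPolynomial {j : ι // j ∉ ({v₀} : Set ι)} k ⧸ Ideal.span {φ₀}) ≃+*
        (MvPolynomial ι k ⧸ Ideal.span {X v₀, rename ((↑) : {j : ι // j ∉ ({v₀} : Set ι)} → ι) φ₀}),
      ∀ p, eq (Ideal.Quotient.mk _ p) = Ideal.Quotient.mk _ (rename ((↑) : {j : ι // j ∉ ({v₀} : Set ι)} → ι) p) := by
  classical
  let ε := Literature.AlgebraicGeometry.Resolution.MvPolynomial.quotientSpanXEquiv (R := k) ({v₀} : Set ι)
  have hεs : ∀ p, ε (Ideal.Quotient.mk _ (rename ((↑) : {j : ι // j ∉ ({v₀} : Set ι)} → ι) p)) = p := fun p => by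
    change Literature.AlgebraicGeometry.Resolution.MvPolynomial.quotientSpanXEquiv (R := k) ({v₀} : Set ι) _ = p
    rw [Literature.AlgebraicGeometry.Resolution.MvPolynomial.quotientSpanXEquiv_mk, killCompl_rename_app]
  have hεsymm : ∀ p, ε.symm p = Ideal.Quotient.mk _ (rename ((↑) : {j : ι // j ∉ ({v₀} : Set ι)} → ι) p) := fun p => by
    conv_lhs => rw [← hεs p]
    exact ε.symm_apply_apply _
  have h1 : (Ideal.span {rename ((↑) : {j : ι // j ∉ ({v₀} : Set ι)} → ι) φ₀}).map
      (Ideal.Quotient.mk (Ideal.span (X '' ({v₀} : Set ι) : Set (MvPolynomial ι k)))) =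
        (Ideal.span {φ₀}).map (ε.symm.toRingEquiv : MvPolynomial {j : ι // j ∉ ({v₀} : Set ι)} k →+* _) := by
    rw [Ideal.map_span, Ideal.map_span, Set.image_singleton (a := rename ((↑) : {j : ι // j ∉ ({v₀} : Set ι)} → ι) φ₀), Set.image_singleton (a := φ₀)]
    exact congrArg (fun z => Ideal.span {z}) (hεsymm φ₀).symm
  let e1 := Ideal.quotientEquiv _ _ ε.symm.toRingEquiv h1
  let e2 := DoubleQuot.quotQuotEquivQuotSup (Ideal.span (X '' ({v₀} : Set ι) : Set (MvPolynomial ι k)))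
    (Ideal.span {rename ((↑) : {j : ι // j ∉ ({v₀} : Set ι)} → ι) φ₀})
  have hJ : Ideal.span (X '' ({v₀} : Set ι) : Set (MvPolynomial ι k)) ⊔ Ideal.span {rename ((↑) : {j : ι // j ∉ ({v₀} : Set ι)} → ι) φ₀} =
      Ideal.span {X v₀, rename ((↑) : {j : ι // j ∉ ({v₀} : Set ι)} → ι) φ₀} := by
    rw [Set.image_singleton, Ideal.span_insert]
  let e3 := Ideal.quotEquivOfEq hJ
  refine ⟨e1.trans (e2.trans e3), fun p => ?_⟩
  rw [RingEquiv.trans_apply, RingEquiv.trans_apply]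
  have he1 : e1 (Ideal.Quotient.mk _ p) = DoubleQuot.quotQuotMk (Ideal.span (X '' ({v₀} : Set ι) : Set (MvPolynomial ι k)))
      (Ideal.span {rename ((↑) : {j : ι // j ∉ ({v₀} : Set ι)} → ι) φ₀}) (rename ((↑) : {j : ι // j ∉ ({v₀} : Set ι)} → ι) p) := by
    change Ideal.quotientEquiv _ _ ε.symm.toRingEquiv h1 (Ideal.Quotient.mk _ p) = _
    rw [Ideal.quotientEquiv_mk]
    exact congrArg (Ideal.Quotient.mk _) (hεsymm p)
  rw [he1, DoubleQuot.quotQuotEquivQuotSup_quotQuotMk, Ideal.quotEquivOfEq_mk]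

set_option maxHeartbeats 1600000 in
/-- ★★ **K1′ OF THE HYPERSURFACE MEMBER `(x_{v₀}, φ)` IN `P = k[x_ι][1/h]`**, `φ = rename φ₀` a polynomial in the other variables: if at every prime `Q` of `k[x_ι]`
with `x_{v₀}, φ ∈ Q` and `h ∉ Q` some partial derivative `∂φ₀/∂x_j` (renamed) is `∉ Q` (pointwise JACOBIAN CERTIFICATE on `D(h)`), and `V(x_{v₀}, φ) ∩ D(h)` has a
`k`-point `pt`, then `(x_{v₀}/1, φ/1)` is a regular sequence on `P` and `P ⧸ (x_{v₀}, φ)` is a regular ring. [OURS · L1 W4.5c · R4c brick (b2); cite: Matsumura1987,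
Thm. 14.2 for the Jacobian criterion] -/
theorem isRegular_away_X_hypersurface [Finite ι] (hh : MvPolynomial ι k) (v₀ : ι) (φ₀ : MvPolynomial {j : ι // j ∉ ({v₀} : Set ι)} k)
    (hjac : ∀ Q : Ideal (MvPolynomial ι k), Q.IsPrime → (X v₀ : MvPolynomial ι k) ∈ Q → rename ((↑) : {j : ι // j ∉ ({v₀} : Set ι)} → ι) φ₀ ∈ Q → hh ∉ Q →
      ∃ j, rename ((↑) : {j : ι // j ∉ ({v₀} : Set ι)} → ι) (pderiv j φ₀) ∉ Q)
    (pt : ι → k) (hpt0 : pt v₀ = 0) (hptφ : MvPolynomial.eval pt (rename ((↑) : {j : ι // j ∉ ({v₀} : Set ι)} → ι) φ₀) = 0)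
    (hu : MvPolynomial.eval pt hh ≠ 0) :
    RingTheory.Sequence.IsRegular (Localization.Away hh)
        (List.ofFn (![algebraMap (MvPolynomial ι k) (Localization.Away hh) (X v₀),
          algebraMap (MvPolynomial ι k) (Localization.Away hh) (rename ((↑) : {j : ι // j ∉ ({v₀} : Set ι)} → ι) φ₀)] : Fin 2 → Localization.Away hh)) ∧
      IsRegularRing (Localization.Away hh ⧸ Ideal.span (Set.range
        (![algebraMap (MvPolynomial ι k) (Localization.Away hh) (X v₀),
          algebraMap (MvPolynomial ι k) (Localization.Away hh) (rename ((↑) : {j : ι // j ∉ ({v₀} : Set ι)} → ι) φ₀)] : Fin 2 → Localization.Away hh))) := by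
  classical
  set φ := rename ((↑) : {j : ι // j ∉ ({v₀} : Set ι)} → ι) φ₀ with hφ
  -- `φ₀ ≠ 0`: the Jacobian certificate at the point `pt`
  have hφ0 : φ₀ ≠ 0 := by
    intro h0
    haveI : (RingHom.ker (MvPolynomial.eval pt : MvPolynomial ι k →+* k)).IsPrime := RingHom.ker_isPrime _
    obtain ⟨j, hj⟩ := hjac (RingHom.ker (MvPolynomial.eval pt)) inferInstance (by rw [RingHom.mem_ker, MvPolynomial.eval_X, hpt0])
      (by rw [RingHom.mem_ker]; exact hptφ) (by rw [RingHom.mem_ker]; exact hu)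
    exact hj (by rw [h0, map_zero, map_zero]; exact Ideal.zero_mem _)
  let ε := Literature.AlgebraicGeometry.Resolution.MvPolynomial.quotientSpanXEquiv (R := k) ({v₀} : Set ι)
  have hεφ : ε (Ideal.Quotient.mk _ φ) = φ₀ := by
    change Literature.AlgebraicGeometry.Resolution.MvPolynomial.quotientSpanXEquiv (R := k) ({v₀} : Set ι) _ = φ₀
    rw [hφ, Literature.AlgebraicGeometry.Resolution.MvPolynomial.quotientSpanXEquiv_mk, killCompl_rename_app]
  -- (i) `(x_{v₀}, φ)` is weakly regular on `k[x_ι]`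
  have hwr : RingTheory.Sequence.IsWeaklyRegular (MvPolynomial ι k) [(X v₀ : MvPolynomial ι k), φ] := by
    rw [RingTheory.Sequence.isWeaklyRegular_iff]
    intro i hi
    have hi2 : i < 2 := by simpa using hi
    rcases i with _ | _ | i
    · have hideal : (Ideal.ofList (List.take 0 [(X v₀ : MvPolynomial ι k), φ]) • ⊤ : Submodule (MvPolynomial ι k) (MvPolynomial ι k)) =
          Ideal.span (X '' (∅ : Set ι) : Set (MvPolynomial ι k)) := by
        simp [Ideal.ofList]
      have key := Literature.AlgebraicGeometry.Resolution.MvPolynomial.isSMulRegular_quotient_span_X (R := k) (∅ : Set ι) (Set.notMem_empty v₀)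
      rw [← hideal] at key
      exact key
    · have hideal : (Ideal.ofList (List.take 1 [(X v₀ : MvPolynomial ι k), φ]) • ⊤ : Submodule (MvPolynomial ι k) (MvPolynomial ι k)) =
          Ideal.span (X '' ({v₀} : Set ι) : Set (MvPolynomial ι k)) := by
        rw [smul_eq_mul, Ideal.mul_top]
        simp [Ideal.ofList]
      haveI := Literature.AlgebraicGeometry.Resolution.MvPolynomial.isDomain_quotient_span_X (R := k) ({v₀} : Set ι)
      have hne : Ideal.Quotient.mk (Ideal.span (X '' ({v₀} : Set ι) : Set (MvPolynomial ι k))) φ ≠ 0 := fun h =>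
        hφ0 (by rw [← hεφ, h, map_zero])
      have key : IsSMulRegular (MvPolynomial ι k ⧸ Ideal.span (X '' ({v₀} : Set ι) : Set (MvPolynomial ι k))) φ :=
        isSMulRegular_quotient_of_isLeftRegular (IsRegular.of_ne_zero' hne).left
      rw [← hideal] at key
      exact key
    · omega
  haveI : Module.Flat (MvPolynomial ι k) (Localization.Away hh) := IsLocalization.flat (Localization.Away hh) (Submonoid.powers hh)
  have hwrP : RingTheory.Sequence.IsWeaklyRegular (Localization.Away hh)
      [algebraMap (MvPolynomial ι k) (Localization.Away hh) (X v₀), algebraMap (MvPolynomial ι k) (Localization.Away hh) φ] := hwr.of_flat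
  have hofFn : (List.ofFn (![algebraMap (MvPolynomial ι k) (Localization.Away hh) (X v₀),
      algebraMap (MvPolynomial ι k) (Localization.Away hh) φ] : Fin 2 → Localization.Away hh)) =
        [algebraMap (MvPolynomial ι k) (Localization.Away hh) (X v₀), algebraMap (MvPolynomial ι k) (Localization.Away hh) φ] := by
    simp [List.ofFn_succ]
  have hrange : Set.range (![algebraMap (MvPolynomial ι k) (Localization.Away hh) (X v₀),
      algebraMap (MvPolynomial ι k) (Localization.Away hh) φ] : Fin 2 → Localization.Away hh) =
        {algebraMap (MvPolynomial ι k) (Localization.Away hh) (X v₀), algebraMap (MvPolynomial ι k) (Localization.Away hh) φ} :=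
    Matrix.range_cons_cons_empty _ _ _
  refine ⟨?_, ?_⟩
  · -- (ii) regular sequence on `P`: weakly regular by flat base change, and `(x_{v₀}, φ)P ≠ P` by evaluation at `pt`
    rw [hofFn]
    refine ⟨hwrP, ?_⟩
    intro htop
    rw [smul_eq_mul, Ideal.mul_top] at htop
    set ψ : Localization.Away hh →+* k := IsLocalization.Away.lift hh (g := MvPolynomial.eval pt) (Ne.isUnit hu) with hψ
    have hle : Ideal.ofList [algebraMap (MvPolynomial ι k) (Localization.Away hh) (X v₀), algebraMap (MvPolynomial ι k) (Localization.Away hh) φ] ≤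
        RingHom.ker ψ := by
      rw [Ideal.ofList, Ideal.span_le]
      intro z hz
      simp only [Set.mem_setOf_eq, List.mem_cons, List.not_mem_nil, or_false] at hz
      rcases hz with rfl | rfl
      · rw [SetLike.mem_coe, RingHom.mem_ker, hψ, IsLocalization.Away.lift_eq, MvPolynomial.eval_X, hpt0]
      · rw [SetLike.mem_coe, RingHom.mem_ker, hψ, IsLocalization.Away.lift_eq, hptφ]
    have h1 : (1 : Localization.Away hh) ∈ Ideal.ofList [algebraMap (MvPolynomial ι k) (Localization.Away hh) (X v₀),
        algebraMap (MvPolynomial ι k) (Localization.Away hh) φ] := by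
      rw [← htop]; trivial
    have := hle h1
    rw [RingHom.mem_ker, map_one] at this
    exact one_ne_zero this
  · -- (iii) the quotient ring: a localisation of `k[x_ι] ⧸ (x_{v₀}, φ) ≅ k[x_{ι∖v₀}] ⧸ (φ₀)`, pointwise regular by the Jacobian criterion
    rw [hrange]
    set J : Ideal (MvPolynomial ι k) := Ideal.span {X v₀, φ} with hJdef
    have hJmap : Ideal.span {algebraMap (MvPolynomial ι k) (Localization.Away hh) (X v₀), algebraMap (MvPolynomial ι k) (Localization.Away hh) φ} =
        J.map (algebraMap (MvPolynomial ι k) (Localization.Away hh)) := by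
      rw [hJdef, Ideal.map_span, Set.image_insert_eq, Set.image_singleton]
    rw [hJmap]
    have hM : Algebra.algebraMapSubmonoid (MvPolynomial ι k ⧸ J) (Submonoid.powers hh) = Submonoid.powers (Ideal.Quotient.mk J hh) :=
      Submonoid.map_powers _ _
    haveI : IsLocalization.Away (Ideal.Quotient.mk J hh) (Localization.Away hh ⧸ J.map (algebraMap (MvPolynomial ι k) (Localization.Away hh))) := by
      change IsLocalization (Submonoid.powers (Ideal.Quotient.mk J hh)) _
      rw [← hM]
      infer_instance
    refine isRegularRing_of_away_of_forall (A := MvPolynomial ι k ⧸ J) (Ideal.Quotient.mk J hh) fun 𝔮 _ h𝔮 => ?_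
    obtain ⟨eq, heq⟩ := exists_quot_X_hypersurface_equiv (k := k) v₀ φ₀
    set Q : Ideal (MvPolynomial ι k) := 𝔮.comap (Ideal.Quotient.mk J) with hQ
    have hJQ : J ≤ Q := fun x hx => by
      rw [hQ, Ideal.mem_comap, Ideal.Quotient.eq_zero_iff_mem.mpr hx]
      exact 𝔮.zero_mem
    have hX : (X v₀ : MvPolynomial ι k) ∈ Q := hJQ (Ideal.subset_span (Set.mem_insert _ _))
    have hφQ : φ ∈ Q := hJQ (Ideal.subset_span (Set.mem_insert_of_mem _ (Set.mem_singleton _)))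
    have hhQ : hh ∉ Q := fun h => h𝔮 (Ideal.mem_comap.mp h)
    obtain ⟨j, hj⟩ := hjac Q inferInstance hX hφQ hhQ
    set P' : Ideal (MvPolynomial {j : ι // j ∉ ({v₀} : Set ι)} k ⧸ Ideal.span {φ₀}) := 𝔮.comap eq with hP'
    have hj' : Ideal.Quotient.mk (Ideal.span {φ₀}) (pderiv j φ₀) ∉ P' := by
      intro h
      rw [hP', Ideal.mem_comap] at h
      change eq _ ∈ 𝔮 at h
      rw [heq] at h
      exact hj (Ideal.mem_comap.mpr h)
    haveI : IsRegularRing (MvPolynomial {j : ι // j ∉ ({v₀} : Set ι)} k) := inferInstance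
    haveI := MvPolynomial.isRegularLocalRing_atPrime_quotient_of_pderiv_notMem P' j hj'
    exact IsRegularLocalRing.of_ringEquiv (R := Localization.AtPrime (𝔮.comap eq))
      (IsLocalization.ringEquivOfRingEquiv (Localization.AtPrime (𝔮.comap eq)) (Localization.AtPrime 𝔮) eq (eq.map_primeCompl_comap_eq 𝔮))

end Summit.ResolutionOfSingularities.ResolutionOfSingularities.Theorems.WildQuotientResolution.S1.FreeModel

end
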